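import Summits.Ventures.PercRepro.Night2TwoOneFaces

/-!
# PercRepro — the cell `(2, 1)` with two fat closures: THE COLUMN BOUND OF THE COMPLETION RULE (night-2, gen 28)

Spread regime of the two-fat-closure clause (`Night2TwoOneColumn`, `Night2TwoOneFaces`).  The big pairs route their
losses by the completion rule along the four off-plane points `Xs = (G ∖ H₀) ∪ (G ∖ H₁)`.  A target `S` receives
load from the covering sets `S ∖ y`, `y ∈ Xs ∩ S`, with a lossy big face; each such covering set meets each class
once, so `|S ∩ Xs| = 3`, it has exactly two completion targets, and at most two such `y` exist: **`dload S ≤ 11/108`**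
(`dload_comp_two_one_le`), and `dload S = 0` unless `|S ∩ Xs| = 3` (`dload_comp_two_one_eq_zero_of_card_ne`).  At a
loaded target the plane part spans `P` with `≥ 4` points and only the lone class point carries a thin face at a class
point, so `L1 S ≤ 7/24 + 7/54 = 91/216` and `cap2 S ≥ 11/18 − 91/216 = 41/216` (`cap2_ge_of_receiving`): the
column bound **`dload_comp_two_one_le_cap2`** holds at every shadow set.
-/

namespace PercRepro.Shadow

open Finset PerFlat ThmH

variable {α : Type*} [DecidableEq α] {M : Matroid α} [M.Finite]

section ColumnB

variable {G : Finset α}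

/-- A set meeting each of two disjoint two-point classes once misses exactly two of their four points. -/
theorem card_sdiff_classes_eq_two {A B Q : Finset α} (hAB : Disjoint A B) (hA : A.card = 2) (hB : B.card = 2)
    {u u' : α} (hQA : Q ∩ A = {u}) (hQB : Q ∩ B = {u'}) : ((A ∪ B) \ Q).card = 2 := by
  have h1 := Finset.card_sdiff_add_card_inter A Q
  have h2 := Finset.card_sdiff_add_card_inter B Q
  rw [Finset.inter_comm, hQA, Finset.card_singleton] at h1
  rw [Finset.inter_comm, hQB, Finset.card_singleton] at h2
  rw [Finset.union_sdiff_distrib, Finset.card_union_of_disjoint (hAB.mono Finset.sdiff_subset Finset.sdiff_subset)]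
  omega

open scoped Classical in
/-- **THE COMPLETION LOAD IS AT MOST `11/108` AT EVERY SET** (cell `(2, 1)`, spread regime, two fat closures with
disjoint missed pairs). -/
theorem dload_comp_two_one_le (hG : G ∈ flatsQ M (5 + 1)) (hd : (gr M \ G).card = 2)
    (hk : kColoops M G = 1) (hs : ∀ e ∈ gr M, ∀ f ∈ gr M, e ≠ f → rkN M {e, f} = 2)
    (hl : ∀ e ∈ gr M, M.Indep {e}) {B₀ B₁ : Finset α} (hB₀ : B₀ ∈ thinMembers M 5 G)
    (hB₁ : B₁ ∈ thinMembers M 5 G) (hm₀ : (G \ clF M B₀).card ≤ 2) (hm₁ : (G \ clF M B₁).card ≤ 2)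
    (hne : clF M B₀ ≠ clF M B₁) (hfat : (fatClosures M 5 G 2).card ≤ 2)
    (hsp : ∀ B ∈ thinMembers M 5 G, 2 < (G \ clF M B).card → 7 ≤ (G \ clF M B).card)
    (hdisj : Disjoint (G \ clF M B₀) (G \ clF M B₁)) (S : Finset α) :
    dload M 5 G (fun B => 5 ≤ (B \ coloops M G).card)
      (dshComp M 5 G ((G \ clF M B₀) ∪ (G \ clF M B₁))) S ≤ 11 / 108 := by
  have hd' : (gr M \ G).card ≤ 5 := by omega
  have hA2 : (G \ clF M B₀).card = 2 := by
    have := two_le_card_sdiff_of_not_lay0 hG hd' (mem_thinMembers.1 hB₀).1 (mem_thinMembers.1 hB₀).2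
    omega
  have hB2 : (G \ clF M B₁).card = 2 := by
    have := two_le_card_sdiff_of_not_lay0 hG hd' (mem_thinMembers.1 hB₁).1 (mem_thinMembers.1 hB₁).2
    omega
  set Xs := (G \ clF M B₀) ∪ (G \ clF M B₁) with hXs
  have h1 := dload_comp_le_sum_faceLossP (M := M) (q := 5) (G := G)
    (P := fun B => 5 ≤ (B \ coloops M G).card) Xs S
  set N := (Xs ∩ S).filter (fun y =>
    ∑ w ∈ S.erase y, faceLossP M 5 G (fun B => 5 ≤ (B \ coloops M G).card) (S.erase y) w ≠ 0) with hN
  have hNsub : N ⊆ Xs ∩ S := Finset.filter_subset _ _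
  -- the structure at a loaded source
  have hstruct : ∀ y ∈ N, ∃ u u', u ≠ u' ∧ (S.erase y) ∩ (G \ clF M B₀) = {u} ∧
      (S.erase y) ∩ (G \ clF M B₁) = {u'} := by
    intro y hy
    have hsum := (Finset.mem_filter.1 hy).2
    obtain ⟨w, hw, hne0⟩ := Finset.exists_ne_zero_of_sum_ne_zero hsum
    obtain ⟨u, u', huu', h₀, h₁, -⟩ :=
      structure_of_faceLossP_ne_zero hG hd hk hs hl hB₀ hB₁ hm₀ hm₁ hne hfat hsp ⟨w, hw, hne0⟩
    exact ⟨u, u', huu', h₀, h₁⟩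
  have hterm : ∀ y ∈ Xs ∩ S,
      (∑ w ∈ S.erase y, faceLossP M 5 G (fun B => 5 ≤ (B \ coloops M G).card) (S.erase y) w) /
        ((Xs \ S.erase y).card : ℚ) ≤ if y ∈ N then 11 / 216 else 0 := by
    intro y hy
    split_ifs with hyN
    · obtain ⟨u, u', -, h₀, h₁⟩ := hstruct y hyN
      have hc := card_sdiff_classes_eq_two hdisj hA2 hB2 h₀ h₁
      rw [← hXs] at hc
      rw [hc]
      have := faceLossP_sum_le_two_one hG hd hk hs hl hB₀ hB₁ hm₀ hm₁ hne hfat hsp (S.erase y)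
      push_cast
      linarith
    · have hzero : ∑ w ∈ S.erase y, faceLossP M 5 G (fun B => 5 ≤ (B \ coloops M G).card) (S.erase y) w = 0 := by
        by_contra h
        exact hyN (Finset.mem_filter.2 ⟨hy, h⟩)
      rw [hzero, zero_div]
  have hN2 : N.card ≤ 2 := by
    apply card_filter_le_two_of_singletons hdisj hNsub
    intro y hy
    obtain ⟨u, u', -, h₀, h₁⟩ := hstruct y hy
    exact ⟨⟨u, h₀⟩, ⟨u', h₁⟩⟩
  calc dload M 5 G (fun B => 5 ≤ (B \ coloops M G).card) (dshComp M 5 G Xs) S ≤ _ := h1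
    _ ≤ ∑ y ∈ Xs ∩ S, (if y ∈ N then (11 / 216 : ℚ) else 0) := Finset.sum_le_sum hterm
    _ = (N.card : ℚ) * (11 / 216) := by
        rw [Finset.sum_ite_mem, Finset.inter_eq_right.2 hNsub, Finset.sum_const, nsmul_eq_mul]
    _ ≤ 2 * (11 / 216) := by
        apply mul_le_mul_of_nonneg_right _ (by norm_num)
        exact_mod_cast hN2
    _ = 11 / 108 := by norm_num

open scoped Classical in
/-- **A loaded target meets `Xs` in exactly three points**: the sources `S ∖ y` meet each class once. -/
theorem card_inter_eq_three_of_dload_ne_zero (hG : G ∈ flatsQ M (5 + 1)) (hd : (gr M \ G).card = 2)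
    (hk : kColoops M G = 1) (hs : ∀ e ∈ gr M, ∀ f ∈ gr M, e ≠ f → rkN M {e, f} = 2)
    (hl : ∀ e ∈ gr M, M.Indep {e}) {B₀ B₁ : Finset α} (hB₀ : B₀ ∈ thinMembers M 5 G)
    (hB₁ : B₁ ∈ thinMembers M 5 G) (hm₀ : (G \ clF M B₀).card ≤ 2) (hm₁ : (G \ clF M B₁).card ≤ 2)
    (hne : clF M B₀ ≠ clF M B₁) (hfat : (fatClosures M 5 G 2).card ≤ 2)
    (hsp : ∀ B ∈ thinMembers M 5 G, 2 < (G \ clF M B).card → 7 ≤ (G \ clF M B).card) {S : Finset α}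
    (hS : dload M 5 G (fun B => 5 ≤ (B \ coloops M G).card)
      (dshComp M 5 G ((G \ clF M B₀) ∪ (G \ clF M B₁))) S ≠ 0) :
    ∃ y ∈ ((G \ clF M B₀) ∪ (G \ clF M B₁)) ∩ S, ∃ u u', u ≠ u' ∧
      (S.erase y) ∩ (G \ clF M B₀) = {u} ∧ (S.erase y) ∩ (G \ clF M B₁) = {u'} ∧
      S.erase y ⊆ G ∧ coloops M G ⊆ S.erase y ∧ rkN M (S.erase y \ coloops M G) = 5 ∧
      6 ≤ (S.erase y \ coloops M G).card ∧
      3 ≤ rkN M (S.erase y ∩ ((clF M B₀ ∩ clF M B₁) \ coloops M G)) ∧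
      4 ≤ (S.erase y ∩ ((clF M B₀ ∩ clF M B₁) \ coloops M G)).card ∧ 4 ≤ (G \ S.erase y).card ∧
      (S ∩ ((G \ clF M B₀) ∪ (G \ clF M B₁))).card = 3 := by
  have hd' : (gr M \ G).card ≤ 5 := by omega
  set Xs := (G \ clF M B₀) ∪ (G \ clF M B₁) with hXs
  have h1 := dload_comp_le_sum_faceLossP (M := M) (q := 5) (G := G)
    (P := fun B => 5 ≤ (B \ coloops M G).card) Xs S
  have h0 : 0 ≤ dload M 5 G (fun B => 5 ≤ (B \ coloops M G).card) (dshComp M 5 G Xs) S :=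
    dload_nonneg (fun B z S => dshComp_nonneg hG hd' Xs B z S) S
  -- some source has a nonzero big-face loss
  have hex : ∃ y ∈ Xs ∩ S,
      ∑ w ∈ S.erase y, faceLossP M 5 G (fun B => 5 ≤ (B \ coloops M G).card) (S.erase y) w ≠ 0 := by
    by_contra hcon
    push Not at hcon
    have : ∑ y ∈ Xs ∩ S, (∑ w ∈ S.erase y, faceLossP M 5 G (fun B => 5 ≤ (B \ coloops M G).card) (S.erase y) w) /
        ((Xs \ S.erase y).card : ℚ) = 0 := by
      apply Finset.sum_eq_zero
      intro y hy
      rw [hcon y hy, zero_div]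
    exact hS (le_antisymm (this ▸ h1) h0)
  obtain ⟨y, hy, hsum⟩ := hex
  obtain ⟨w, hw, hne0⟩ := Finset.exists_ne_zero_of_sum_ne_zero hsum
  obtain ⟨u, u', huu', h₀, h₁, hQG, hKQ, hQK5, hQKcard, hP3, hP4, hGQ⟩ :=
    structure_of_faceLossP_ne_zero hG hd hk hs hl hB₀ hB₁ hm₀ hm₁ hne hfat hsp ⟨w, hw, hne0⟩
  refine ⟨y, hy, u, u', huu', h₀, h₁, hQG, hKQ, hQK5, hQKcard, hP3, hP4, hGQ, ?_⟩
  -- `S ∩ Xs = insert y ((S ∖ y) ∩ Xs)` and `(S ∖ y) ∩ Xs = {u, u′}`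
  have hQX : (S.erase y) ∩ Xs = {u, u'} := by
    rw [hXs, Finset.inter_union_distrib_left, h₀, h₁]
    rfl
  have hSX : S ∩ Xs = insert y ((S.erase y) ∩ Xs) := by
    ext x
    simp only [Finset.mem_inter, Finset.mem_insert, Finset.mem_erase]
    constructor
    · rintro ⟨hxS, hxX⟩
      by_cases hxy : x = y
      · exact Or.inl hxy
      · exact Or.inr ⟨⟨hxy, hxS⟩, hxX⟩
    · rintro (rfl | ⟨⟨-, hxS⟩, hxX⟩)
      · exact ⟨(Finset.mem_inter.1 hy).2, (Finset.mem_inter.1 hy).1⟩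
      · exact ⟨hxS, hxX⟩
  rw [hSX, hQX, Finset.card_insert_of_notMem, Finset.card_pair huu']
  intro h
  rw [← hQX, Finset.mem_inter, Finset.mem_erase] at h
  exact h.1.1 rfl

open scoped Classical in
/-- **NO LOAD UNLESS `|S ∩ Xs| = 3`**. -/
theorem dload_comp_two_one_eq_zero_of_card_ne (hG : G ∈ flatsQ M (5 + 1)) (hd : (gr M \ G).card = 2)
    (hk : kColoops M G = 1) (hs : ∀ e ∈ gr M, ∀ f ∈ gr M, e ≠ f → rkN M {e, f} = 2)
    (hl : ∀ e ∈ gr M, M.Indep {e}) {B₀ B₁ : Finset α} (hB₀ : B₀ ∈ thinMembers M 5 G)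
    (hB₁ : B₁ ∈ thinMembers M 5 G) (hm₀ : (G \ clF M B₀).card ≤ 2) (hm₁ : (G \ clF M B₁).card ≤ 2)
    (hne : clF M B₀ ≠ clF M B₁) (hfat : (fatClosures M 5 G 2).card ≤ 2)
    (hsp : ∀ B ∈ thinMembers M 5 G, 2 < (G \ clF M B).card → 7 ≤ (G \ clF M B).card) {S : Finset α}
    (h3 : (S ∩ ((G \ clF M B₀) ∪ (G \ clF M B₁))).card ≠ 3) :
    dload M 5 G (fun B => 5 ≤ (B \ coloops M G).card)
      (dshComp M 5 G ((G \ clF M B₀) ∪ (G \ clF M B₁))) S = 0 := by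
  by_contra hS
  obtain ⟨-, -, -, -, -, -, -, -, -, -, -, -, -, -, hc⟩ :=
    card_inter_eq_three_of_dload_ne_zero hG hd hk hs hl hB₀ hB₁ hm₀ hm₁ hne hfat hsp hS
  exact h3 hc

open scoped Classical in
/-- **THE RESIDUAL CAPACITY OF A LOADED TARGET IS AT LEAST `41/216`**: its thin covering preimages are the face at
the lone class point (`≤ 7/24`) and at most one face at a plane point (`≤ 7/54`). -/
theorem cap2_ge_of_receiving (hG : G ∈ flatsQ M (5 + 1)) (hd : (gr M \ G).card = 2)
    (hk : kColoops M G = 1) (hs : ∀ e ∈ gr M, ∀ f ∈ gr M, e ≠ f → rkN M {e, f} = 2)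
    (hl : ∀ e ∈ gr M, M.Indep {e}) {B₀ B₁ : Finset α} (hB₀ : B₀ ∈ thinMembers M 5 G)
    (hB₁ : B₁ ∈ thinMembers M 5 G) (hm₀ : (G \ clF M B₀).card ≤ 2) (hm₁ : (G \ clF M B₁).card ≤ 2)
    (hne : clF M B₀ ≠ clF M B₁) (hfat : (fatClosures M 5 G 2).card ≤ 2)
    (hsp : ∀ B ∈ thinMembers M 5 G, 2 < (G \ clF M B).card → 7 ≤ (G \ clF M B).card)
    (hdisj : Disjoint (G \ clF M B₀) (G \ clF M B₁)) {S : Finset α} (hSG : S ⊆ G)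
    (hS : dload M 5 G (fun B => 5 ≤ (B \ coloops M G).card)
      (dshComp M 5 G ((G \ clF M B₀) ∪ (G \ clF M B₁))) S ≠ 0) :
    (41 / 216 : ℚ) ≤ cap2 M 5 G S := by
  have hd' : (gr M \ G).card ≤ 5 := by omega
  obtain ⟨y, hy, u, u', huu', h₀, h₁, hQG, hKQ, -, -, hP3, hP4, -, -⟩ :=
    card_inter_eq_three_of_dload_ne_zero hG hd hk hs hl hB₀ hB₁ hm₀ hm₁ hne hfat hsp hS
  set Xs := (G \ clF M B₀) ∪ (G \ clF M B₁) with hXs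
  have hyS : y ∈ S := (Finset.mem_inter.1 hy).2
  have hyX : y ∈ Xs := (Finset.mem_inter.1 hy).1
  -- `y` is off the plane, so the plane part of `S` is that of `S ∖ y`
  have hyP : y ∉ (clF M B₀ ∩ clF M B₁) \ coloops M G := by
    intro h
    rw [Finset.mem_sdiff, Finset.mem_inter] at h
    rw [hXs, Finset.mem_union, Finset.mem_sdiff, Finset.mem_sdiff] at hyX
    rcases hyX with hh | hh
    · exact hh.2 h.1.1
    · exact hh.2 h.1.2
  have hSP : S ∩ ((clF M B₀ ∩ clF M B₁) \ coloops M G) = S.erase y ∩ ((clF M B₀ ∩ clF M B₁) \ coloops M G) := by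
    ext x
    simp only [Finset.mem_inter, Finset.mem_erase]
    constructor
    · rintro ⟨hxS, hxP⟩
      exact ⟨⟨fun h => hyP (h ▸ hxP), hxS⟩, hxP⟩
    · rintro ⟨⟨-, hxS⟩, hxP⟩
      exact ⟨hxS, hxP⟩
  have hSP3 : 3 ≤ rkN M (S ∩ ((clF M B₀ ∩ clF M B₁) \ coloops M G)) := by rw [hSP]; exact hP3
  have hSP4 : 4 ≤ (S ∩ ((clF M B₀ ∩ clF M B₁) \ coloops M G)).card := by rw [hSP]; exact hP4
  have huQ : u ∈ (S.erase y) ∩ (G \ clF M B₀) := by rw [h₀]; exact Finset.mem_singleton_self _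
  have hu'Q : u' ∈ (S.erase y) ∩ (G \ clF M B₁) := by rw [h₁]; exact Finset.mem_singleton_self _
  have huS : u ∈ S ∩ (G \ clF M B₀) :=
    Finset.mem_inter.2 ⟨Finset.mem_of_mem_erase (Finset.mem_inter.1 huQ).1, (Finset.mem_inter.1 huQ).2⟩
  have hu'S : u' ∈ S ∩ (G \ clF M B₁) :=
    Finset.mem_inter.2 ⟨Finset.mem_of_mem_erase (Finset.mem_inter.1 hu'Q).1, (Finset.mem_inter.1 hu'Q).2⟩
  have huy : u ≠ y := fun h => (Finset.mem_erase.1 (Finset.mem_inter.1 huQ).1).1 h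
  have hu'y : u' ≠ y := fun h => (Finset.mem_erase.1 (Finset.mem_inter.1 hu'Q).1).1 h
  have hL1 := L1_le_of_spanning hG hd hk hs hB₀ hB₁ hm₀ hm₁ hne hfat hsp hdisj hSG hSP3 hSP4 huS hu'S
  -- at most one thin face at a class point: the lone point of the class met once
  have hWX : ((S ∩ Xs).filter (fun w => S.erase w ∈ thinMembers M 5 G)).card ≤ 1 := by
    rw [hXs, Finset.mem_union] at hyX
    rcases hyX with hyA | hyB
    · -- the class `G ∖ H₀` has the two points `u, y` in `S`: its faces are not thin; the other class gives `u′` only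
      apply Finset.card_le_one.2
      intro w₁ hw₁ w₂ hw₂
      have key : ∀ w ∈ (S ∩ Xs).filter (fun w => S.erase w ∈ thinMembers M 5 G), w = u' := by
        intro w hw
        rw [Finset.mem_filter, Finset.mem_inter, hXs, Finset.mem_union] at hw
        rcases hw.1.2 with hwA | hwB
        · exfalso
          have hsing := class_inter_eq_singleton_of_thin_face hG hd hk hB₀ hB₁ hdisj hSP3 hu'S
            (Finset.mem_inter.2 ⟨hw.1.1, hwA⟩) hw.2
          have hu_in : u ∈ (G \ clF M B₀) ∩ S := Finset.mem_inter.2 ⟨(Finset.mem_inter.1 huS).2, (Finset.mem_inter.1 huS).1⟩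
          have hy_in : y ∈ (G \ clF M B₀) ∩ S := Finset.mem_inter.2 ⟨hyA, hyS⟩
          rw [hsing, Finset.mem_singleton] at hu_in hy_in
          exact huy (hu_in.trans hy_in.symm)
        · have hsing := class_inter_eq_singleton_of_thin_face' hG hd hk hB₀ hB₁ hdisj hSP3 huS
            (Finset.mem_inter.2 ⟨hw.1.1, hwB⟩) hw.2
          have hu'_in : u' ∈ (G \ clF M B₁) ∩ S := Finset.mem_inter.2 ⟨(Finset.mem_inter.1 hu'S).2, (Finset.mem_inter.1 hu'S).1⟩
          rw [hsing, Finset.mem_singleton] at hu'_in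
          exact hu'_in.symm
      rw [key w₁ hw₁, key w₂ hw₂]
    · apply Finset.card_le_one.2
      intro w₁ hw₁ w₂ hw₂
      have key : ∀ w ∈ (S ∩ Xs).filter (fun w => S.erase w ∈ thinMembers M 5 G), w = u := by
        intro w hw
        rw [Finset.mem_filter, Finset.mem_inter, hXs, Finset.mem_union] at hw
        rcases hw.1.2 with hwA | hwB
        · have hsing := class_inter_eq_singleton_of_thin_face hG hd hk hB₀ hB₁ hdisj hSP3 hu'S
            (Finset.mem_inter.2 ⟨hw.1.1, hwA⟩) hw.2
          have hu_in : u ∈ (G \ clF M B₀) ∩ S := Finset.mem_inter.2 ⟨(Finset.mem_inter.1 huS).2, (Finset.mem_inter.1 huS).1⟩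
          rw [hsing, Finset.mem_singleton] at hu_in
          exact hu_in.symm
        · exfalso
          have hsing := class_inter_eq_singleton_of_thin_face' hG hd hk hB₀ hB₁ hdisj hSP3 huS
            (Finset.mem_inter.2 ⟨hw.1.1, hwB⟩) hw.2
          have hu'_in : u' ∈ (G \ clF M B₁) ∩ S := Finset.mem_inter.2 ⟨(Finset.mem_inter.1 hu'S).2, (Finset.mem_inter.1 hu'S).1⟩
          have hy_in : y ∈ (G \ clF M B₁) ∩ S := Finset.mem_inter.2 ⟨hyB, hyS⟩
          rw [hsing, Finset.mem_singleton] at hu'_in hy_in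
          exact hu'y (hu'_in.trans hy_in.symm)
      rw [key w₁ hw₁, key w₂ hw₂]
  have hWX' : (((S ∩ Xs).filter (fun w => S.erase w ∈ thinMembers M 5 G)).card : ℚ) ≤ 1 := by
    exact_mod_cast hWX
  have hL1' : L1 M 5 G S ≤ 91 / 216 := by
    rw [← hXs] at hL1
    nlinarith
  have hcap := capS_ge_eleven_eighteenths_two_one hd hk hSG
  have hfS : fS M 5 G S = 1 := by
    unfold fS
    rw [if_pos (by linarith)]
  unfold cap2
  rw [hfS, one_mul]
  linarith

open scoped Classical in
/-- **THE COLUMN BOUND OF THE COMPLETION RULE** at every shadow set of the cell. -/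
theorem dload_comp_two_one_le_cap2 (hG : G ∈ flatsQ M (5 + 1)) (hd : (gr M \ G).card = 2)
    (hk : kColoops M G = 1) (hs : ∀ e ∈ gr M, ∀ f ∈ gr M, e ≠ f → rkN M {e, f} = 2)
    (hl : ∀ e ∈ gr M, M.Indep {e}) {B₀ B₁ : Finset α} (hB₀ : B₀ ∈ thinMembers M 5 G)
    (hB₁ : B₁ ∈ thinMembers M 5 G) (hm₀ : (G \ clF M B₀).card ≤ 2) (hm₁ : (G \ clF M B₁).card ≤ 2)
    (hne : clF M B₀ ≠ clF M B₁) (hfat : (fatClosures M 5 G 2).card ≤ 2)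
    (hsp : ∀ B ∈ thinMembers M 5 G, 2 < (G \ clF M B).card → 7 ≤ (G \ clF M B).card)
    (hdisj : Disjoint (G \ clF M B₀) (G \ clF M B₁)) :
    ∀ S ∈ shadowAt M (5 + 2) 5 (Uq M (5 + 2) 5) G,
      dload M 5 G (fun B => 5 ≤ (B \ coloops M G).card)
        (dshComp M 5 G ((G \ clF M B₀) ∪ (G \ clF M B₁))) S ≤ cap2 M 5 G S := by
  intro S hS
  have hd' : (gr M \ G).card ≤ 5 := by omega
  have hSG : S ⊆ G := subset_G_of_mem_shadowAt hS
  by_cases h0 : dload M 5 G (fun B => 5 ≤ (B \ coloops M G).card)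
      (dshComp M 5 G ((G \ clF M B₀) ∪ (G \ clF M B₁))) S = 0
  · rw [h0]
    exact cap2_nonneg (capS_nonneg' hG hd' S)
  · have h1 := dload_comp_two_one_le hG hd hk hs hl hB₀ hB₁ hm₀ hm₁ hne hfat hsp hdisj S
    have h2 := cap2_ge_of_receiving hG hd hk hs hl hB₀ hB₁ hm₀ hm₁ hne hfat hsp hdisj hSG h0
    linarith

end ColumnB

end PercRepro.Shadow
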